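import Literature.NumberTheory.Automorphic.UnitaryGroupLocalReflections
import Literature.NumberTheory.Automorphic.UnitaryRankThreeDiagonal
import Literature.NumberTheory.QuadraticForms.HermitianLocalIsotropy
import Literature.NumberTheory.Automorphic.UnitaryGroupSymplecticCarriers
import HarnessLib

/-!
# Homomorphisms out of `U(J)(F_v)`, `J = T ⊗ 1` of rank `3`, at a NON-SPLIT place see only the determinant

Topic `NumberTheory/Automorphic`; namespace `Literature.NumberTheory.Automorphic.UnitaryGroup.LocalRankThree`.
KERNEL only: theorems, no definition, no named fact, no `sorry`.

Setting (the currency of the rank-one theta rows `RankOneThetaLift*.lean` of the Hodge/COR-CM interface, row IV-4c3):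
`E/F` a quadratic extension of number fields with `c ∈ Aut(E/F)`, `c δ = -δ ≠ 0`, `T ∈ M₃(F)` symmetric with `det T`
a unit, `J = T.map (algebraMap F E)`, a finite place `v` of `F` with `E ⊗_F F_v` a FIELD (non-split `v`), and the
tree's local group `U(J)(F_v) = UnitaryGroup.«local» E c 3 J v ≤ GL₃(E ⊗_F F_v)` (factor form
`UnitaryGroup.localPi E c 3 J v`, `localPiEquiv`).

* §1 **`apply_eq_one_of_det_eq_one`** — every homomorphism `θ : U(J)(F_v) →* A` to a commutative group kills the
  elements of determinant `1` (`SU(J)(F_v) ≤ ker θ`); `apply_eq_of_det_eq` — `θ g` depends only on `det g`;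
  `localPi_apply_eq_one_of_det_eq_one` — the same on the factor form.  NO continuity is assumed.  This is the
  field engine `UnitaryRankThree.apply_eq_one_of_det_eq_one_diagonal` ([Dieudonne1971GroupesClassiques, Chap. II
  §5]: `SU₃` of an isotropic hermitian form is perfect) transported along an `F`-rational orthogonal basis of `T`
  (`UnitaryGroup.exists_orthogonal_rows`) and fed with local isotropy in rank `3`
  (`QuadraticForms.HermitianLocal.exists_isotropic_localRing`, [Jacobson1940HermitianForms]); the CM/diagonal
  instance is the tree's `UnitaryGroup.AdelicCharactersDet.localPi_apply_eq_one`.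
* §2 **quasi-reflections exhaust the determinant**: `det (1 + a · u ⊗ uᵀJ_v) = 1 + a h(u,u)` (`det_reflMatrix`); for
  an `F`-rational `u` with `h(u,u) ≠ 0` and every `z` of norm one there is a quasi-reflection along `u` in `U(J)(F_v)`
  of determinant `z` (`exists_refl_det_eq`); hence **two homomorphisms `U(J)(F_v) →* A` that agree on the
  quasi-reflections along ONE anisotropic rational vector are equal** (`eq_of_forall_refl_eq`), and a homomorphism
  trivial on them is trivial (`eq_one_of_forall_refl`) — the unitary group `U(L) ≅ E_v¹` of the line `L = E_v u`
  detects every character of `U(J)(F_v)`.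

Consumer: the twist-rigidity programme for row IV-4c3 `rankOne_theta_twist_rigidity` (two sections over `ι_v` differ by
a character of `U(J)(F_v)`, `MpPsi.exists_character_of_proj_eq`; by §1–§2 that character is read on `U(L)`).
Cell hodgecm-mathlib (fan B); HC_CM is NOT proved here and is proved only modulo the printed citations until rung 0 closes.

## References
* J. Dieudonné, *La géométrie des groupes classiques*, 3e éd. (1971), Chap. II §§4–5 [Dieudonne1971GroupesClassiques].
* N. Jacobson, *A note on hermitian forms*, Bull. AMS 46 (1940), §3 [Jacobson1940HermitianForms].
* V. Platonov, A. Rapinchuk, *Algebraic Groups and Number Theory* (1994), §7.2 (Kneser–Tits for isotropic groups)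
  [PlatonovRapinchuk1994].
-/

set_option autoImplicit false

noncomputable section

open NumberField IsDedekindDomain Matrix
open scoped MatrixGroups

namespace Literature.NumberTheory.Automorphic.UnitaryGroup.LocalRankThree

open Literature.NumberTheory.Automorphic Literature.NumberTheory.QuadraticForms

variable {F : Type} [Field F] [NumberField F] (E : Type) [Field E] [NumberField E] [Algebra F E]
  [Algebra.IsQuadraticExtension F E] (c : E ≃ₐ[F] E)
  {δ : E} (hcδ : c δ = -δ) (hδ : δ ≠ 0)
  (T : Matrix (Fin 3) (Fin 3) F) (hT : T.IsSymm) (hTd : IsUnit T.det)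
  {J : Matrix (Fin 3) (Fin 3) E} (hJ : J = T.map (algebraMap F E))
  (v : HeightOneSpectrum (𝓞 F))

/-! ## §0 Small algebra -/

omit [NumberField F] [Algebra.IsQuadraticExtension F E] in
include hcδ hδ in
/-- `c ≠ 1` when `c δ = -δ ≠ 0` (characteristic zero). [folklore] -/
private theorem ringEquiv_ne_one : c ≠ 1 := by
  intro h
  rw [h, AlgEquiv.one_apply] at hcδ
  have h2 : (2 : E) * δ = 0 := by linear_combination hcδ
  exact hδ ((mul_eq_zero.1 h2).resolve_left two_ne_zero)

omit [NumberField F] [Algebra.IsQuadraticExtension F E] in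
/-- The local form matrix of `U(J)(F_v)` for `J = T ⊗ 1` is `T` pushed along `F → E → E ⊗_F F_v`. [folklore] -/
private theorem localForm_eq_map_map (hJ : J = T.map (algebraMap F E)) :
    (adelicForm E 3 J).map (adeleToLocal E v) =
      T.map ((algebraMap E (LocalRing E v)).comp (algebraMap F E)) := by
  rw [adelicForm, hJ, Matrix.map_map, Matrix.map_map]
  rfl

/-! ## §1 `SU(J)(F_v) ≤ ker θ` at a non-split place -/

include hcδ hδ hT hTd hJ in
/-- **Every homomorphism `U(J)(F_v) →* A` into a commutative group kills the elements of determinant one**, for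
`J = T ⊗ 1` of rank `3` (`T` symmetric, `det T` a unit) at a place `v` with `E ⊗_F F_v` a field: transport of
`UnitaryRankThree.apply_eq_one_of_det_eq_one_diagonal` along an `F`-rational orthogonal basis of `T`, the diagonal
form being isotropic over the field `E ⊗_F F_v` in rank `3`.  No continuity hypothesis.
[cite: Dieudonne1971GroupesClassiques, Chap. II §5] -/
theorem apply_eq_one_of_det_eq_one (hE : IsField (LocalRing E v)) {A : Type*} [CommGroup A]
    (θ : ↥(UnitaryGroup.«local» E c 3 J v) →* A) (g : ↥(UnitaryGroup.«local» E c 3 J v))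
    (hdet : g.1.1.det = 1) : θ g = 1 := by
  classical
  letI : Field (LocalRing E v) := hE.toField
  set σ := conjLocal E c v with hσdef
  set ι : F →+* LocalRing E v := (algebraMap E (LocalRing E v)).comp (algebraMap F E) with hι
  have hc : c ≠ 1 := ringEquiv_ne_one E c hcδ hδ
  have hσσ : ∀ x, σ (σ x) = x := fun x => by
    obtain ⟨⟨a, b⟩, rfl⟩ := (quadraticLocalEquiv E v c hcδ hδ).surjective x
    rw [hσdef, conjLocal_quadraticLocalEquiv, conjLocal_quadraticLocalEquiv, neg_neg]
  have hθ₀ : σ (algebraMap E (LocalRing E v) δ) = -algebraMap E (LocalRing E v) δ := by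
    rw [hσdef, conjLocal_algebraMap, hcδ, map_neg]
  have hθ₀0 : algebraMap E (LocalRing E v) δ ≠ 0 := (map_ne_zero _).2 hδ
  have h2 : (2 : LocalRing E v) ≠ 0 := by
    rw [← map_ofNat (algebraMap E (LocalRing E v)) 2]; exact (map_ne_zero _).2 two_ne_zero
  have hσι : ∀ x : F, σ (ι x) = ι x := fun x => by
    rw [hι, RingHom.comp_apply, hσdef, conjLocal_algebraMap, AlgEquiv.commutes]
  -- an `F`-rational orthogonal basis for `T`
  obtain ⟨b, cb, Q, hcb, hbb, hbo, hQ⟩ := UnitaryGroup.exists_orthogonal_rows T hT hTd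
  set B : Matrix (Fin 3) (Fin 3) F := Matrix.of b with hB
  have hBTB : B * T * Bᵀ = Matrix.diagonal cb := by
    ext i j
    have hij : (B * T * Bᵀ) i j = (b i ᵥ* T) ⬝ᵥ b j := by
      rw [Matrix.mul_apply]
      simp only [Matrix.transpose_apply, hB, Matrix.of_apply, dotProduct, Matrix.vecMul, Matrix.mul_apply]
    rw [hij, Matrix.diagonal_apply]
    by_cases h : i = j
    · subst h; rw [if_pos rfl, hbb]
    · rw [if_neg h, hbo i j h]
  have hQB : Q * (B * T) = 1 := by rw [hB]; exact hQ
  have hBdet : B.det ≠ 0 := by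
    intro h0
    have := congrArg Matrix.det hQB
    rw [Matrix.det_mul, Matrix.det_mul, h0, zero_mul, mul_zero, Matrix.det_one] at this
    exact zero_ne_one this
  -- the change of basis `P = (B ⊗ 1)ᵀ ∈ GL₃(K)`
  have hPdet : ((B.map ι)ᵀ).det ≠ 0 := by
    rw [Matrix.det_transpose, ← RingHom.mapMatrix_apply, ← RingHom.map_det]
    exact (map_ne_zero _).2 hBdet
  set P : GL (Fin 3) (LocalRing E v) := Matrix.GeneralLinearGroup.mkOfDetNeZero _ hPdet with hP
  have hPval : P.1 = (B.map ι)ᵀ := rfl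
  have hPσ : P.1.map σ = P.1 := by
    rw [hPval]; ext i j; simp only [Matrix.map_apply, Matrix.transpose_apply, hσι]
  -- the local form and its diagonalisation
  have hH : (adelicForm E 3 J).map (adeleToLocal E v) = T.map ι := localForm_eq_map_map E T v hJ
  set d : Fin 3 → LocalRing E v := fun i => ι (cb i) with hd
  have hcongr : formCongr σ P ((adelicForm E 3 J).map (adeleToLocal E v)) = Matrix.diagonal d := by
    show (P.1.map σ)ᵀ * (adelicForm E 3 J).map (adeleToLocal E v) * P.1 = Matrix.diagonal d
    rw [hPσ, hH, hPval, Matrix.transpose_transpose, ← Matrix.transpose_map, ← Matrix.map_mul,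
      ← Matrix.map_mul, hBTB, Matrix.diagonal_map (map_zero ι)]
  have hdσ : ∀ i, σ (d i) = d i := fun i => hσι (cb i)
  have hd0 : ∀ i, d i ≠ 0 := fun i => (map_ne_zero ι).2 (hcb i)
  -- isotropy of the diagonal form over the field `E ⊗_F F_v`
  have hiso : ∃ x : Fin 3 → LocalRing E v, x ≠ 0 ∧ ∑ i, σ (x i) * d i * x i = 0 := by
    obtain ⟨x, hx, hsum⟩ := HermitianLocal.exists_isotropic_localRing E c hc v (le_refl 3)
      (d := fun i => algebraMap F E (cb i)) (fun i => AlgEquiv.commutes c (cb i))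
    exact ⟨x, hx, by simpa only [hd, hι, RingHom.comp_apply] using hsum⟩
  exact UnitaryRankThree.apply_eq_one_of_det_eq_one_of_formCongr P _ _ hcongr
    (fun χ' g' h' => UnitaryRankThree.apply_eq_one_of_det_eq_one_diagonal hσσ hθ₀ hθ₀0 h2 d hdσ hd0 hiso χ' g' h')
    θ g hdet

include hcδ hδ hT hTd hJ in
/-- **A homomorphism `U(J)(F_v) →* A` into a commutative group sees only the determinant**: `det g = det g' ⟹ θ g = θ g'`
(rank `3`, `J = T ⊗ 1`, non-split `v`). [cite: Dieudonne1971GroupesClassiques, Chap. II §5] -/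
theorem apply_eq_of_det_eq (hE : IsField (LocalRing E v)) {A : Type*} [CommGroup A]
    (θ : ↥(UnitaryGroup.«local» E c 3 J v) →* A) (g g' : ↥(UnitaryGroup.«local» E c 3 J v))
    (hdet : g.1.1.det = g'.1.1.det) : θ g = θ g' := by
  have hd : Matrix.GeneralLinearGroup.det g.1 = Matrix.GeneralLinearGroup.det g'.1 :=
    Units.ext (by rwa [Matrix.GeneralLinearGroup.val_det_apply, Matrix.GeneralLinearGroup.val_det_apply])
  have hdet1 : (g'⁻¹ * g : ↥(UnitaryGroup.«local» E c 3 J v)).1.1.det = 1 := by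
    rw [← Matrix.GeneralLinearGroup.val_det_apply, Subgroup.coe_mul, Subgroup.coe_inv, map_mul, map_inv, hd,
      inv_mul_cancel, Units.val_one]
  have h := apply_eq_one_of_det_eq_one E c hcδ hδ T hT hTd hJ v hE θ (g'⁻¹ * g) hdet1
  rwa [map_mul, map_inv, inv_mul_eq_one, eq_comm] at h

include hcδ hδ hT hTd hJ in
/-- §1 on the factor form `localPi E c 3 J v ≤ Π_{w ∣ v} GL₃(E_w)`: a homomorphism into a commutative group kills
every element all of whose components have determinant one. [cite: Dieudonne1971GroupesClassiques, Chap. II §5] -/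
theorem localPi_apply_eq_one_of_det_eq_one (hE : IsField (LocalRing E v)) {A : Type*} [CommGroup A]
    (θ : ↥(UnitaryGroup.localPi E c 3 J v) →* A) (u : ↥(UnitaryGroup.localPi E c 3 J v))
    (hu : ∀ w : UnitaryGroup.PlacesOver E v,
      (((u : UnitaryGroup.LocalGLPi E 3 v) w : GL (Fin 3) (w.1.adicCompletion E)) :
        Matrix (Fin 3) (Fin 3) (w.1.adicCompletion E)).det = 1) : θ u = 1 := by
  set ψ := UnitaryGroup.localPiEquiv E c 3 J v with hψ
  have hup : u = ψ.symm (ψ u) := (ψ.symm_apply_apply u).symm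
  have hpdet : (ψ u : ↥(UnitaryGroup.«local» E c 3 J v)).1.1.det = 1 := by
    funext w'
    have hmat : ((((ψ.symm (ψ u) : ↥(UnitaryGroup.localPi E c 3 J v)) : UnitaryGroup.LocalGLPi E 3 v) w' :
        GL (Fin 3) (w'.1.adicCompletion E)) : Matrix (Fin 3) (Fin 3) (w'.1.adicCompletion E)) =
        (ψ u : ↥(UnitaryGroup.«local» E c 3 J v)).1.1.map
          (Pi.evalRingHom (fun w'' : UnitaryGroup.PlacesOver E v => w''.1.adicCompletion E) w') :=
      GLn.coe_piEquiv_apply _ _ _ _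
    have h1 := hu w'
    rw [hup, hmat, ← RingHom.mapMatrix_apply, ← RingHom.map_det] at h1
    exact h1
  have key := apply_eq_one_of_det_eq_one E c hcδ hδ T hT hTd hJ v hE (θ.comp ψ.symm.toMonoidHom) (ψ u) hpdet
  rw [hup]
  exact key

/-! ## §2 Quasi-reflections along one rational anisotropic vector detect every homomorphism -/

section Refl

variable {R : Type*} [CommRing R] {n : Type*} [Fintype n] [DecidableEq n]

/-- **determinant of a quasi-reflection**: `det (1 + a · u ⊗ r) = 1 + a ⟨r, u⟩`.
[cite: Dieudonne1971GroupesClassiques, Chap. II §4] -/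
theorem det_reflMatrix (u r : n → R) (a : R) : (1 + a • vecMulVec u r).det = 1 + a * (r ⬝ᵥ u) := by
  have h : a • vecMulVec u r = replicateCol Unit (a • u) * replicateRow Unit r := by
    rw [← vecMulVec_eq, smul_vecMulVec]
  rw [h, Matrix.det_one_add_replicateCol_mul_replicateRow, dotProduct_smul, smul_eq_mul]

end Refl

omit [Algebra.IsQuadraticExtension F E] in
include hT hJ in
/-- **quasi-reflections along a rational anisotropic vector exhaust the norm-one group**: for `u ∈ F³` with
`h(u,u) = uᵀ T u ≠ 0` and every `z ∈ E ⊗_F F_v` with `σ(z) z = 1` there is `g ∈ U(J)(F_v)` of the shape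
`g = 1 + a · u ⊗ uᵀJ_v` with `det g = z` (the unitary group of the line `E_v u`, acting on it by `z`; `a = (z - 1)/h(u,u)`).
[cite: Dieudonne1971GroupesClassiques, Chap. II §4] -/
theorem exists_refl_det_eq (hE : IsField (LocalRing E v)) (u : Fin 3 → F) (hu : (u ᵥ* T) ⬝ᵥ u ≠ 0)
    (z : LocalRing E v) (hz : conjLocal E c v z * z = 1) :
    ∃ g : ↥(UnitaryGroup.«local» E c 3 J v), (∃ a : LocalRing E v,
      g.1.1 = 1 + a • vecMulVec (fun i => toLocalRing E v ((u i : F) : v.adicCompletion F))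
            ((fun i => toLocalRing E v ((u i : F) : v.adicCompletion F)) ᵥ*
              (T.map (algebraMap F (v.adicCompletion F))).map (toLocalRing E v))) ∧
      g.1.1.det = z := by
  set uv : Fin 3 → LocalRing E v := fun i => toLocalRing E v ((u i : F) : v.adicCompletion F) with huv
  set Jv := (T.map (algebraMap F (v.adicCompletion F))).map (toLocalRing E v) with hJv
  set h₀ : LocalRing E v := toLocalRing E v ((((u ᵥ* T) ⬝ᵥ u : F)) : v.adicCompletion F) with hh₀
  -- `h(u,u)` read in `E ⊗ F_v` is `h₀`, a non-zero `σ`-fixed scalar with inverse `k`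
  have hpair : (uv ᵥ* Jv) ⬝ᵥ uv = h₀ := by
    rw [hh₀, huv, hJv]
    exact UnitaryGroup.ratVec_vecMul_dotProduct E T v u
  have hh₀0 : h₀ ≠ 0 := by
    rw [hh₀, toLocalRing_coe]
    exact (map_ne_zero _).2 ((map_ne_zero _).2 hu)
  have hσh₀ : conjLocal E c v h₀ = h₀ := by rw [hh₀, conjLocal_toLocalRing]
  obtain ⟨k, hk⟩ : ∃ k : LocalRing E v, h₀ * k = 1 := hE.mul_inv_cancel hh₀0
  have hσk : conjLocal E c v k = k := by
    have h1 : h₀ * conjLocal E c v k = 1 := by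
      have := congrArg (conjLocal E c v) hk
      rwa [map_mul, map_one, hσh₀] at this
    calc conjLocal E c v k = (h₀ * k) * conjLocal E c v k := by rw [hk, one_mul]
      _ = (h₀ * conjLocal E c v k) * k := by ring
      _ = k := by rw [h1, one_mul]
  set a : LocalRing E v := (z - 1) * k with ha
  have hσa : conjLocal E c v a = (conjLocal E c v z - 1) * k := by
    rw [ha, map_mul, map_sub, map_one, hσk]
  -- the admissibility relation `a + σ a + a σ a h(u,u) = 0` ⟸ `σ(z) z = 1`
  have hadm : a + conjLocal E c v a + a * conjLocal E c v a * ((uv ᵥ* Jv) ⬝ᵥ uv) = 0 := by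
    rw [hpair, hσa, ha]
    linear_combination k * hz + (z - 1) * (conjLocal E c v z - 1) * k * hk
  obtain ⟨g, hg⟩ := UnitaryGroup.reflMatrix_mem_local E c T hT hJ v u (a := a) hadm
  refine ⟨g, ⟨a, hg⟩, ?_⟩
  · rw [show g.1.1 = 1 + a • vecMulVec uv (uv ᵥ* Jv) from hg, det_reflMatrix, hpair, ha]
    linear_combination (z - 1) * hk

include hcδ hδ hT hTd hJ in
/-- **Two homomorphisms `U(J)(F_v) →* A` that agree on the quasi-reflections along ONE rational anisotropic vector
are equal** (rank `3`, non-split `v`): every `g` has the determinant of such a quasi-reflection (`exists_refl_det_eq`,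
`det g` has norm one), and homomorphisms see only the determinant (`apply_eq_of_det_eq`).
[cite: Dieudonne1971GroupesClassiques, Chap. II §5] -/
theorem eq_of_forall_refl_eq (hE : IsField (LocalRing E v)) {A : Type*} [CommGroup A]
    (u : Fin 3 → F) (hu : (u ᵥ* T) ⬝ᵥ u ≠ 0) (θ θ' : ↥(UnitaryGroup.«local» E c 3 J v) →* A)
    (h : ∀ g : ↥(UnitaryGroup.«local» E c 3 J v), (∃ a : LocalRing E v,
      g.1.1 = 1 + a • vecMulVec (fun i => toLocalRing E v ((u i : F) : v.adicCompletion F))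
          ((fun i => toLocalRing E v ((u i : F) : v.adicCompletion F)) ᵥ*
            (T.map (algebraMap F (v.adicCompletion F))).map (toLocalRing E v))) → θ g = θ' g) :
    θ = θ' := by
  letI : Field (LocalRing E v) := hE.toField
  -- `θ / θ'` kills the quasi-reflections along `u`, hence everything
  refine MonoidHom.ext fun g => ?_
  -- `det g` has norm one
  have hJu : IsUnit ((adelicForm E 3 J).map (adeleToLocal E v)).det := by
    rw [localForm_eq_map_map E T v hJ, ← RingHom.mapMatrix_apply, ← RingHom.map_det]
    exact hTd.map _
  have hnorm : conjLocal E c v g.1.1.det * g.1.1.det = 1 := by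
    have hg : (g.1.1.map (conjLocal E c v))ᵀ * (adelicForm E 3 J).map (adeleToLocal E v) * g.1.1 =
        (adelicForm E 3 J).map (adeleToLocal E v) := mem_unitaryGroupOfForm_iff.1 g.2
    have hd := congrArg Matrix.det hg
    rw [Matrix.det_mul, Matrix.det_mul, Matrix.det_transpose, ← RingHom.mapMatrix_apply, ← RingHom.map_det]
      at hd
    -- `σ(det g) * det J_v * det g = det J_v`; cancel `det J_v ≠ 0`
    refine mul_right_cancel₀ hJu.ne_zero ?_
    rw [one_mul]
    linear_combination hd
  obtain ⟨r, hr, hrdet⟩ := exists_refl_det_eq E c T hT hJ v hE u hu _ hnorm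
  have h1 : θ g = θ r := apply_eq_of_det_eq E c hcδ hδ T hT hTd hJ v hE θ g r (by rw [hrdet])
  have h2 : θ' g = θ' r := apply_eq_of_det_eq E c hcδ hδ T hT hTd hJ v hE θ' g r (by rw [hrdet])
  rw [h1, h2]
  exact h r hr

include hcδ hδ hT hTd hJ in
/-- **A homomorphism `U(J)(F_v) →* A` trivial on the quasi-reflections along ONE rational anisotropic vector is
trivial** (rank `3`, non-split `v`) — the unitary group `U(L) ≅ E_v¹` of the line `L = E_v u` detects every
character of `U(J)(F_v)`. [cite: Dieudonne1971GroupesClassiques, Chap. II §5] -/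
theorem eq_one_of_forall_refl (hE : IsField (LocalRing E v)) {A : Type*} [CommGroup A]
    (u : Fin 3 → F) (hu : (u ᵥ* T) ⬝ᵥ u ≠ 0) (θ : ↥(UnitaryGroup.«local» E c 3 J v) →* A)
    (h : ∀ g : ↥(UnitaryGroup.«local» E c 3 J v), (∃ a : LocalRing E v,
      g.1.1 = 1 + a • vecMulVec (fun i => toLocalRing E v ((u i : F) : v.adicCompletion F))
          ((fun i => toLocalRing E v ((u i : F) : v.adicCompletion F)) ᵥ*
            (T.map (algebraMap F (v.adicCompletion F))).map (toLocalRing E v))) → θ g = 1) :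
    θ = 1 :=
  eq_of_forall_refl_eq E c hcδ hδ T hT hTd hJ v hE u hu θ 1 fun g hg => by rw [h g hg, MonoidHom.one_apply]

end Literature.NumberTheory.Automorphic.UnitaryGroup.LocalRankThree

end
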